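import Literature.AnabelianGeometry.EtaleTheta.ArithThetaTowerDivisorMonoids
import Literature.AnabelianGeometry.EtaleTheta.LogDivisorModelTateTower
import HarnessLib

/-!
# [EtTh] Def. 3.1 / Def. 3.3 (iii) for the ARITHMETIC theta tower (GAP A, item GA-02), part 3: the DECREED theta envelope of the kit's
# `(Π, Π_Ÿ)` — the finite `Ÿ_T`-avatar of the [EtTh] §1 ℤ-covering with its theta translates, as a log-divisor model with `Π`-action

S. Mochizuki, *The étale theta function …*, Publ. RIMS **45** (2009) [MochizukiEtTh2009], §1 p.12 (PDF) («the special fiber of `𝔜` … an infinite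
chain of copies of the projective line», Gal(`Y/X`) `= ℤ`), Prop. 1.4 (i) PDF p.21 («the zeroes of `Θ̈` on `Ÿ` are precisely the cusps of `Ÿ`; each
zero has multiplicity 1. The divisor of poles of `Θ̈` on `Ÿ` is precisely the divisor `D_1`»), Rmk. 1.3.1 (the divisor `D_1` does not descend),
Def. 3.1 / Prop. 3.2 PDF p.70, Def. 3.3 (iii) p.73 [cite: MochizukiEtTh2009, Def 3.1 p.70]; [IUTchI] Ex. 3.2 (ii) p.70 («`Ÿ_v → X̲̲_v` … we may
think of `Ÿ_v` as an object of `𝒟_v`») [claim: Mochizuki2012, status: disputed — nothing of the series is asserted].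

abc-iut cell, GAP A = G-L5-EX32I-1, item **GA-02** (chair's ruled shape `plan/L5/GAP-A-SIGNATURES.md` v1 e3ccddf9b87597cf §2; RULINGS #322 (c2′):
«Φ₀^geom … of the level-n_T piece of the [EtTh] §1 ℤ(×μ₂)-covering», GAP-SIZING-A §9 (f1)/§10), seat abc-iut-gapA-02-divisorMonoids.  CLASS (b)
MODEL, consumed BY NAME: the frozen interfaces `LogDivisorModel` / `GaloisAction` / `CuspLaws` (`TemperedCoverings.lean`,
`LogDivisorModelGaloisAction.lean`), the Tate-skeleton lemma `TateTower.int_eq_zero_of_divisible` (`LogDivisorModelTateTower.lean`), this seat's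
`ArithThetaTower.NΘ` (`ArithThetaTowerDivisorMonoids.lean`).  The geometric log-divisor model DECREED FROM `T` by print's recipe:

* `envelopeModel T : LogDivisorModel` — the FINITE `Ÿ_T`-AVATAR of the universal combinatorial covering: cusps AND special-fibre components
  both indexed by the fibre `Fib T := Π ⧸ Π_Ÿ` of `Ÿ_T → X̲̲_v̲` (one cusp on each component, as on the chain `Ÿ` of [EtTh] §1; `n_T := [Π : Π_Ÿ]`
  of them), `DIV = ℤ^{cusps ⊔ components}`, every log-divisor Cartier; log-meromorphic functions = the free abelian group on the THETA
  TRANSLATES `θ_x`, `x ∈ Fib T` («`ϖ̈`-free, constant-free»: `const = 𝒪^▷ = 1` — the constants live in the GENUINE factor of the engine),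
  with `div θ_x := [all cusps] − [F_x]` (Prop. 1.4 (i): simple zero at every cusp; polar divisor the component `F_x` — the finite-avatar `D_1`);
  Prop. 3.2 (ii)/(iii) PROVED (an effective combination of theta divisors is trivial; the function group is free).
* `envelopeAction T : (envelopeModel T).GaloisAction Π` — `Π` acts by left translation of the fibre on cusps, components, divisors and theta
  translates (`g·θ_x = θ_{g·x}`); every law PROVED; it FACTORS THROUGH `Γ_Θ T = Π ⧸ N_Θ T` (`smul_fib_eq_of_mem_NΘ`,
  `envelopeAction_actFn_eq_of_mem_NΘ`, `envelopeAction_actDIV_eq_of_mem_NΘ`: the normal core of `Π_Ÿ` acts trivially) — i.e. the geometric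
  factor is pulled back along `rebase T` (#321/#322 (c3′)); `envelope_cuspLaws`.
The ruled decl `ArithThetaTower.divisorMonoids d T` (the engine at this envelope) and the theta section `θ ∈ B₀(Ÿ_T)` are the sequel
`ArithThetaTowerCarrier.lean`.

FINITE-AVATAR DEVIATIONS, LABELLED (RULINGS #322 (c3′)/GUARD): print's `Ÿ → X̲̲` is an infinite tempered `ℤ × μ₂`-covering and `D_1` is the
non-periodic pattern of Prop. 1.4 on the infinite chain, which descends to NO finite covering (Rmk. 1.3.1); the kit's `Π_Ÿ` is an open subgroup
(finite index for profinite `Π`), so here `D_1 := F_{1·Π_Ÿ}` (one component, multiplicity one); [EtTh] Def 3.3 Φ at general U and print's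
Ÿ̈/μ_N Kummer levels = FOUNDATIONS 13/14, not claimed.  No `Prop`-valued fact, no instance, no notation, no sorry.  HONEST FRAMING: a DECREED
combinatorial avatar over typed interfaces; NOT asserted to be the tempered Frobenioid of a Tate curve; no side taken on [IUTchIII] Cor. 3.12
(this is the undisputed construction around it); typed ≠ inhabited ≠ proved-in-print; count-neutral; NO abc claim.
-/

noncomputable section

namespace Literature.AnabelianGeometry.EtaleTheta

open CategoryTheory Opposite Function Literature.AlgebraicGeometry.Frobenioids
  Literature.AlgebraicGeometry.Frobenioids.PadicFrd Literature.AnabelianGeometry.SemiGraphs Literature.IUT.HodgeTheaters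
  LogDivisorModel LogDivisorModel.GaloisAction

namespace ArithThetaTower

variable {p : ℕ} [Fact p.Prime] (d : GaloisValDatum.{0} p) {P : Type} [Group P] [TopologicalSpace P]
  (T : BadLocalGroupDatum d.Gal P)

/-! ## §1 The fibre of `Ÿ_T → X̲̲_v̲` and the log-divisor model of the finite `Ÿ_T`-avatar -/

/-- **The fibre `Fib T := Π ⧸ Π_Ÿ` of `Ÿ_T → X̲̲_v̲`** (`n_T = [Π : Π_Ÿ]` points, `Π` acting by left translation): the index set of the cusps
AND of the special-fibre components of the avatar (one cusp per component, [EtTh] §1). [cite: MochizukiEtTh2009, Def 3.1 p.70] -/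
abbrev Fib : Type := P ⧸ (T.Y : Subgroup P)

/-- Prime log-divisors of the avatar: cusps ⊔ components. [cite: MochizukiEtTh2009, Def 3.1 p.70] -/
abbrev Idx : Type := Fib d T ⊕ Fib d T

/-- The base point `1·Π_Ÿ` of the fibre (the component carrying `D_1`). [cite: MochizukiEtTh2009, Prop 1.4 p.21] -/
def basePt : Fib d T := ((1 : P) : P ⧸ (T.Y : Subgroup P))

/-- **The divisor of the theta monomial `∏ θ_x^{n_x}`**: multiplicity `Σ_x n_x` at EVERY cusp (each `θ_x` has a simple zero at every cusp,
Prop. 1.4 (i)) and `−n_j` along the component `F_j` (the polar divisor of `θ_j` is `F_j`). [cite: MochizukiEtTh2009, Prop 1.4 p.21] -/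
def thetaDivFun (n : Fib d T →₀ ℤ) : Idx d T → ℤ
  | Sum.inl _ => n.sum fun _ k => k
  | Sum.inr j => -n j

/-- `thetaDivFun` is additive. [cite: MochizukiEtTh2009, Def 3.1 p.70] -/
theorem thetaDivFun_add (n m : Fib d T →₀ ℤ) : thetaDivFun d T (n + m) = thetaDivFun d T n + thetaDivFun d T m := by
  funext x
  rcases x with c | j
  · simp only [thetaDivFun, Pi.add_apply]
    exact Finsupp.sum_add_index' (fun _ => rfl) (fun _ _ _ => rfl)
  · simp only [thetaDivFun, Pi.add_apply, Finsupp.add_apply, neg_add]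

/-- The divisor map `⟨θ_x⟩ → DIV` as a homomorphism of multiplicative groups. [cite: MochizukiEtTh2009, Def 3.1 p.70] -/
def thetaDivHom : Multiplicative (Fib d T →₀ ℤ) →* Multiplicative (Idx d T → ℤ) :=
  AddMonoidHom.toMultiplicative
    { toFun := thetaDivFun d T
      map_zero' := by
        funext x; rcases x with c | j
        · simp [thetaDivFun]
        · simp [thetaDivFun]
      map_add' := thetaDivFun_add d T }

/-- `thetaDivHom` on elements. [cite: MochizukiEtTh2009, Def 3.1 p.70] -/
@[simp] theorem toAdd_thetaDivHom (f : Multiplicative (Fib d T →₀ ℤ)) (x : Idx d T) :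
    Multiplicative.toAdd (thetaDivHom d T f) x = thetaDivFun d T (Multiplicative.toAdd f) x := rfl

/-- **Prop. 3.2 (ii) for the avatar, with content**: a theta monomial with EFFECTIVE divisor is trivial (all components force `n ≤ 0`, any
cusp forces `Σ n ≥ 0`). [cite: MochizukiEtTh2009, Prop 3.2 p.70] -/
theorem eq_zero_of_thetaDivFun_nonneg (n : Fib d T →₀ ℤ) (h : ∀ x, 0 ≤ thetaDivFun d T n x) : n = 0 := by
  have hle : ∀ j, n j ≤ 0 := fun j => by have := h (Sum.inr j); simp only [thetaDivFun] at this; linarith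
  have hsum : 0 ≤ n.sum fun _ k => k := h (Sum.inl (basePt d T))
  have hsum' : (n.sum fun _ k => k) = ∑ j ∈ n.support, n j := rfl
  have hzero : ∀ j ∈ n.support, n j = 0 :=
    (Finset.sum_eq_zero_iff_of_nonpos fun j _ => hle j).mp
      (le_antisymm (Finset.sum_nonpos fun j _ => hle j) (hsum' ▸ hsum))
  ext j
  by_cases hj : j ∈ n.support
  · exact hzero j hj
  · exact Finsupp.notMem_support_iff.mp hj

/-- The divisor map of the avatar is injective (read off the components). [cite: MochizukiEtTh2009, Def 3.1 p.70] -/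
theorem thetaDivFun_injective : Injective (thetaDivFun d T) := fun n m h => by
  ext j
  have := congrFun h (Sum.inr j)
  simp only [thetaDivFun, neg_inj] at this
  exact this

/-- **The log-divisor model of the finite `Ÿ_T`-avatar** (every field PROVED): cusps and components indexed by the fibre, `DIV = ℤ^{cusps ⊔
components}` all Cartier, functions = theta monomials with `div θ_x = [cusps] − [F_x]`, NO constants (`const = 𝒪^▷ = 1`).
[cite: MochizukiEtTh2009, Def 3.1 p.70] -/
def envelopeModel : LogDivisorModel.{0} where
  Fn := Multiplicative (Fib d T →₀ ℤ)
  DIV := Multiplicative (Idx d T → ℤ)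
  DIVplus :=
    { carrier := {e | ∀ x, 0 ≤ Multiplicative.toAdd e x}
      mul_mem' := fun {a b} ha hb x => by
        rw [toAdd_mul, Pi.add_apply]; exact add_nonneg (ha x) (hb x)
      one_mem' := fun x => by rw [toAdd_one, Pi.zero_apply] }
  Div := ⊤
  exists_div_eq e := by
    refine ⟨Multiplicative.ofAdd fun x => max (Multiplicative.toAdd e x) 0, fun x => ?_,
      Multiplicative.ofAdd fun x => max (-Multiplicative.toAdd e x) 0, fun x => ?_, ?_⟩
    · rw [toAdd_ofAdd]; exact le_max_right _ _
    · rw [toAdd_ofAdd]; exact le_max_right _ _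
    · refine Multiplicative.toAdd.injective (funext fun x => ?_)
      rw [toAdd_mul, toAdd_ofAdd, toAdd_ofAdd, Pi.add_apply]
      rcases le_total 0 (Multiplicative.toAdd e x) with h | h
      · rw [max_eq_left h, max_eq_right (neg_nonpos.mpr h), add_zero]
      · rw [max_eq_right h, max_eq_left (neg_nonneg.mpr h), add_neg_cancel]
  eq_one_of_mem_of_inv_mem e he he' := by
    refine Multiplicative.toAdd.injective (funext fun x => le_antisymm ?_ (he x))
    have h := he' x
    rw [toAdd_inv, Pi.neg_apply] at h
    rw [toAdd_one, Pi.zero_apply]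
    linarith
  nonCuspidal :=
    { carrier := {e | ∀ c, Multiplicative.toAdd e (Sum.inl c) = 0}
      mul_mem' := fun {a b} ha hb c => by rw [toAdd_mul, Pi.add_apply, ha, hb, add_zero]
      one_mem' := fun c => by rw [toAdd_one, Pi.zero_apply]
      inv_mem' := fun {a} ha c => by rw [toAdd_inv, Pi.neg_apply, ha, neg_zero] }
  cuspidal :=
    { carrier := {e | ∀ j, Multiplicative.toAdd e (Sum.inr j) = 0}
      mul_mem' := fun {a b} ha hb j => by rw [toAdd_mul, Pi.add_apply, ha, hb, add_zero]
      one_mem' := fun j => by rw [toAdd_one, Pi.zero_apply]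
      inv_mem' := fun {a} ha j => by rw [toAdd_inv, Pi.neg_apply, ha, neg_zero] }
  nonCuspidal_isCompl_cuspidal := by
    constructor
    · rw [Subgroup.disjoint_def]
      intro e h₁ h₂
      refine Multiplicative.toAdd.injective (funext fun x => ?_)
      rcases x with c | j
      · exact h₁ c
      · exact h₂ j
    · rw [codisjoint_iff, eq_top_iff]
      rintro e -
      have he : (Multiplicative.ofAdd fun x => Sum.elim (fun _ => (0 : ℤ)) (fun j => Multiplicative.toAdd e (Sum.inr j)) x) *
          (Multiplicative.ofAdd fun x => Sum.elim (fun c => Multiplicative.toAdd e (Sum.inl c)) (fun _ => (0 : ℤ)) x) = e :=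
        Multiplicative.toAdd.injective (funext fun x => by rcases x with c | j <;> simp)
      rw [← he]
      exact Subgroup.mul_mem_sup (fun c => by simp) (fun j => by simp)
  logMero := ⊤
  divisor := (thetaDivHom d T).comp (Subgroup.subtype ⊤)
  divisor_mem_Div _ := trivial
  const := ⊥
  const_le_logMero := bot_le
  intConst := ⊥
  intConst_le_const := bot_le
  temperedMero := ⊤
  temperedMero_le_logMero := le_rfl
  exists_pow_mem_Div := ⟨1, fun _ => trivial⟩
  Cusp := Fib d T
  Comp := Fib d T
  divPlusEquiv :=
    { toFun := fun e x => Multiplicative.ofAdd (Multiplicative.toAdd e.1 x).toNat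
      invFun := fun m => ⟨Multiplicative.ofAdd fun x => ((Multiplicative.toAdd (m x) : ℕ) : ℤ), fun x => by
        rw [toAdd_ofAdd]; exact Int.natCast_nonneg _⟩
      left_inv := fun e => Subtype.ext (Multiplicative.toAdd.injective (funext fun x => by
        simp only [toAdd_ofAdd]
        exact Int.toNat_of_nonneg (e.2 x)))
      right_inv := fun m => funext fun x => by simp
      map_mul' := fun a b => funext fun x => by
        rw [Pi.mul_apply, ← ofAdd_add]
        congr 1
        rw [Submonoid.coe_mul, toAdd_mul, Pi.add_apply]
        exact Int.toNat_add (a.2 x) (b.2 x) }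
  divPlusEquiv_nonCuspidal e := by
    refine forall_congr' fun c => ?_
    change Multiplicative.toAdd e.1 (Sum.inl c) = 0 ↔ Multiplicative.ofAdd (Multiplicative.toAdd e.1 (Sum.inl c)).toNat = 1
    have h0 : 0 ≤ Multiplicative.toAdd e.1 (Sum.inl c) := e.2 _
    constructor
    · intro h; rw [h]; rfl
    · intro h
      have h' : (Multiplicative.toAdd e.1 (Sum.inl c)).toNat = 0 := Multiplicative.ofAdd.injective (h.trans ofAdd_zero.symm)
      exact le_antisymm (Int.toNat_eq_zero.mp h') h0
  mem_intConst_of_divisor_mem f hf := by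
    have h : ∀ x, 0 ≤ thetaDivFun d T (Multiplicative.toAdd f.1) x := hf
    have h0 := eq_zero_of_thetaDivFun_nonneg d T _ h
    have : f.1 = 1 := Multiplicative.toAdd.injective h0
    rw [Submonoid.mem_bot]
    exact this
  divisor_mem_of_mem_intConst f hf := by
    have h1 : (f : Multiplicative (Fib d T →₀ ℤ)) = 1 := Submonoid.mem_bot.mp hf
    have hf1 : f = 1 := Subtype.ext h1
    subst hf1
    refine ⟨fun x => ?_, fun c => ?_⟩
    · rw [map_one, toAdd_one, Pi.zero_apply]
    · rw [map_one, toAdd_one, Pi.zero_apply]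
  divisor_eq_one_iff f := by
    constructor
    · intro h
      have h' : thetaDivFun d T (Multiplicative.toAdd f.1) = thetaDivFun d T 0 := by
        have e := congrArg Multiplicative.toAdd h
        funext x
        have ex := congrFun e x
        simp only [MonoidHom.coe_comp, Subgroup.coe_subtype, Function.comp_apply, toAdd_thetaDivHom, toAdd_one,
          Pi.zero_apply] at ex
        rw [ex]
        rcases x with c | j <;> simp [thetaDivFun]
      have h0 : Multiplicative.toAdd f.1 = 0 := thetaDivFun_injective d T h'
      have h1 : (f : Multiplicative (Fib d T →₀ ℤ)) = 1 := Multiplicative.toAdd.injective h0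
      refine ⟨Submonoid.mem_bot.mpr h1, Submonoid.mem_bot.mpr ?_⟩
      rw [h1, inv_one]
    · rintro ⟨hf, -⟩
      have h1 : (f : Multiplicative (Fib d T →₀ ℤ)) = 1 := Submonoid.mem_bot.mp hf
      have hf1 : f = 1 := Subtype.ext h1
      rw [hf1, map_one]
  eq_one_of_forall_exists_pow_eq f hf := by
    refine Multiplicative.toAdd.injective (Finsupp.ext fun j => ?_)
    refine TateTower.int_eq_zero_of_divisible _ fun N => ?_
    obtain ⟨g, hg⟩ := hf N
    refine ⟨Multiplicative.toAdd g j, ?_⟩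
    have e := congrArg (fun u : Multiplicative (Fib d T →₀ ℤ) => Multiplicative.toAdd u j) hg
    simp only [toAdd_pow, Finsupp.smul_apply] at e
    exact e

/-! ## §2 `Π` acting on the avatar by left translation of the fibre (factors through `Γ_Θ = Π ⧸ N_Θ`) -/

/-- The permutation of the prime log-divisors by `g ∈ Π`: left translation on cusps and on components. [cite: MochizukiEtTh2009, Def 3.3 p.73] -/
def permIdx (g : P) : Idx d T ≃ Idx d T := Equiv.sumCongr (MulAction.toPerm g) (MulAction.toPerm g)

/-- `permIdx 1 = id`. [cite: MochizukiEtTh2009, Def 3.3 p.73] -/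
theorem permIdx_one : permIdx d T 1 = Equiv.refl _ := by
  ext x; rcases x with c | j <;> simp [permIdx]

/-- `permIdx (g h) = permIdx g ∘ permIdx h`. [cite: MochizukiEtTh2009, Def 3.3 p.73] -/
theorem permIdx_mul (g h : P) : permIdx d T (g * h) = (permIdx d T h).trans (permIdx d T g) := by
  ext x; rcases x with c | j <;> simp [permIdx, mul_smul]

/-- The action of `g` on log-divisors: `e ↦ e ∘ (permIdx g)⁻¹`. [cite: MochizukiEtTh2009, Def 3.3 p.73] -/
def actDIVEquiv (g : P) : Multiplicative (Idx d T → ℤ) ≃* Multiplicative (Idx d T → ℤ) where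
  toFun e := Multiplicative.ofAdd fun x => Multiplicative.toAdd e ((permIdx d T g).symm x)
  invFun e := Multiplicative.ofAdd fun x => Multiplicative.toAdd e (permIdx d T g x)
  left_inv e := Multiplicative.toAdd.injective (funext fun x => by simp)
  right_inv e := Multiplicative.toAdd.injective (funext fun x => by simp)
  map_mul' a b := Multiplicative.toAdd.injective (funext fun x => by simp)

/-- `actDIVEquiv g e` evaluated. [cite: MochizukiEtTh2009, Def 3.3 p.73] -/
@[simp] theorem toAdd_actDIVEquiv (g : P) (e : Multiplicative (Idx d T → ℤ)) (x : Idx d T) :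
    Multiplicative.toAdd (actDIVEquiv d T g e) x = Multiplicative.toAdd e ((permIdx d T g).symm x) := by
  simp [actDIVEquiv]

/-- `Π` acting on the log-divisors of the avatar. [cite: MochizukiEtTh2009, Def 3.3 p.73] -/
def actDIVHom : P →* MulAut (Multiplicative (Idx d T → ℤ)) where
  toFun := actDIVEquiv d T
  map_one' := MulEquiv.ext fun e => Multiplicative.toAdd.injective (funext fun x => by
    rw [toAdd_actDIVEquiv, permIdx_one, MulAut.one_apply]; rfl)
  map_mul' g h := MulEquiv.ext fun e => Multiplicative.toAdd.injective (funext fun x => by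
    rw [MulAut.mul_apply, toAdd_actDIVEquiv, toAdd_actDIVEquiv, toAdd_actDIVEquiv, permIdx_mul]; rfl)

/-- The action of `g` on theta monomials: `θ_x ↦ θ_{g·x}` (reindexing the exponent vector). [cite: MochizukiEtTh2009, Def 3.3 p.73] -/
def actFnEquiv (g : P) : Multiplicative (Fib d T →₀ ℤ) ≃* Multiplicative (Fib d T →₀ ℤ) :=
  AddEquiv.toMultiplicative (Finsupp.domCongr (MulAction.toPerm g))

/-- `actFnEquiv g n` evaluated at `b`: the exponent of `θ_b` in `g·n` is that of `θ_{g⁻¹ b}` in `n`. [cite: MochizukiEtTh2009, Def 3.3 p.73] -/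
@[simp] theorem toAdd_actFnEquiv_apply (g : P) (n : Multiplicative (Fib d T →₀ ℤ)) (b : Fib d T) :
    Multiplicative.toAdd (actFnEquiv d T g n) b = Multiplicative.toAdd n (g⁻¹ • b) := by
  change Finsupp.equivMapDomain (MulAction.toPerm g) (Multiplicative.toAdd n) b = _
  rw [Finsupp.equivMapDomain_apply, MulAction.toPerm_symm_apply]

/-- `Π` acting on the theta monomials. [cite: MochizukiEtTh2009, Def 3.3 p.73] -/
def actFnHom : P →* MulAut (Multiplicative (Fib d T →₀ ℤ)) where
  toFun := actFnEquiv d T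
  map_one' := MulEquiv.ext fun n => Multiplicative.toAdd.injective (Finsupp.ext fun b => by
    rw [toAdd_actFnEquiv_apply, inv_one, one_smul, MulAut.one_apply])
  map_mul' g h := MulEquiv.ext fun n => Multiplicative.toAdd.injective (Finsupp.ext fun b => by
    rw [MulAut.mul_apply, toAdd_actFnEquiv_apply, toAdd_actFnEquiv_apply, toAdd_actFnEquiv_apply, mul_inv_rev, mul_smul])

/-- The degree `Σ_x n_x` of a theta monomial is invariant under reindexing. [cite: MochizukiEtTh2009, Def 3.3 p.73] -/
theorem sum_actFnEquiv (g : P) (n : Multiplicative (Fib d T →₀ ℤ)) :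
    ((Multiplicative.toAdd (actFnEquiv d T g n)).sum fun _ k => k) = (Multiplicative.toAdd n).sum fun _ k => k := by
  change ((Finsupp.equivMapDomain (MulAction.toPerm g) (Multiplicative.toAdd n)).sum fun _ k => k) = _
  rw [Finsupp.sum_equivMapDomain]

/-- **The Galois action of `Π` on the finite `Ÿ_T`-avatar** (every law PROVED): left translation of the fibre on cusps, components,
log-divisors and theta translates; «divisor of zeroes and poles» is equivariant (`div θ_{g·x} = g·div θ_x`). [cite: MochizukiEtTh2009, Def 3.3 p.73] -/
def envelopeAction : (envelopeModel d T).GaloisAction P where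
  actFn := actFnHom d T
  actDIV := actDIVHom d T
  permCusp := MulAction.toPermHom P (Fib d T)
  permComp := MulAction.toPermHom P (Fib d T)
  act_mem_DIVplus g e he x := by
    change 0 ≤ Multiplicative.toAdd (actDIVEquiv d T g e) x
    rw [toAdd_actDIVEquiv]
    exact he _
  act_mem_Div _ _ _ := trivial
  act_mem_logMero _ _ _ := trivial
  act_mem_const g f hf := by
    have h1 : f = 1 := Subgroup.mem_bot.mp hf
    rw [h1, map_one]
    exact Subgroup.one_mem _
  act_mem_intConst g f hf := by
    have h1 : f = 1 := Submonoid.mem_bot.mp hf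
    rw [h1, map_one]
    exact Submonoid.one_mem _
  divisor_act g f := by
    refine Multiplicative.toAdd.injective (funext fun x => ?_)
    change thetaDivFun d T (Multiplicative.toAdd (actFnEquiv d T g f.1)) x =
      Multiplicative.toAdd (actDIVEquiv d T g (thetaDivHom d T f.1)) x
    rw [toAdd_actDIVEquiv, toAdd_thetaDivHom]
    rcases x with c | j
    · simp only [thetaDivFun, permIdx, Equiv.sumCongr_symm, Equiv.sumCongr_apply, Sum.map_inl]
      exact sum_actFnEquiv d T g f.1
    · simp only [thetaDivFun, permIdx, Equiv.sumCongr_symm, Equiv.sumCongr_apply, Sum.map_inr, toAdd_actFnEquiv_apply,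
        MulAction.toPerm_symm_apply]
  mult_act g e x := by
    obtain ⟨e, he⟩ := e
    change (Multiplicative.toAdd (actDIVEquiv d T g e) (permIdx d T g x)).toNat = (Multiplicative.toAdd e x).toNat
    rw [toAdd_actDIVEquiv, Equiv.symm_apply_apply]
    rfl

/-- The tacit cusp laws hold for the avatar (all log-divisors Cartier; cuspidal = no multiplicity along components).
[cite: MochizukiEtTh2009, Def 3.1 p.70] -/
theorem envelope_cuspLaws : (envelopeModel d T).CuspLaws where
  cuspidal_le_Div := fun _ _ => trivial
  mem_cuspidal_iff e := by
    refine forall_congr' fun j => ?_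
    change Multiplicative.toAdd e.1 (Sum.inr j) = 0 ↔ (Multiplicative.toAdd e.1 (Sum.inr j)).toNat = 0
    rw [Int.toNat_eq_zero]
    exact ⟨fun h => h.le, fun h => le_antisymm h (e.2 _)⟩

/-- **`N_Θ` acts trivially on the fibre**: for `n` in the normal core of `Π_Ÿ`, `n·(xΠ_Ÿ) = xΠ_Ÿ` (`x⁻¹ n x ∈ Π_Ÿ`) — so the envelope action
FACTORS THROUGH `Γ_Θ T = Π ⧸ N_Θ T` (the geometric factor is pulled back along `rebase T`). [cite: MochizukiEtTh2009, Def 3.3 p.73] -/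
theorem smul_fib_eq_of_mem_NΘ {n : P} (hn : n ∈ NΘ d T) (x : Fib d T) : n • x = x := by
  induction x using QuotientGroup.induction_on with
  | H a =>
    rw [MulAction.Quotient.smul_coe, QuotientGroup.eq, smul_eq_mul]
    have h := (Subgroup.inv_mem _ hn) a⁻¹
    rw [inv_inv] at h
    -- `(n * a)⁻¹ * a = a⁻¹ * n⁻¹ * a⁻¹⁻¹`
    simpa [mul_inv_rev, mul_assoc] using h

/-- `N_Θ` acts trivially on theta monomials. [cite: MochizukiEtTh2009, Def 3.3 p.73] -/
theorem envelopeAction_actFn_eq_of_mem_NΘ {n : P} (hn : n ∈ NΘ d T) (f : (envelopeModel d T).Fn) :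
    (envelopeAction d T).actFn n f = f := by
  change actFnEquiv d T n f = f
  refine Multiplicative.toAdd.injective (Finsupp.ext fun b => ?_)
  rw [toAdd_actFnEquiv_apply, smul_fib_eq_of_mem_NΘ d T ((NΘ d T).inv_mem hn)]

/-- `N_Θ` acts trivially on log-divisors. [cite: MochizukiEtTh2009, Def 3.3 p.73] -/
theorem envelopeAction_actDIV_eq_of_mem_NΘ {n : P} (hn : n ∈ NΘ d T) (e : (envelopeModel d T).DIV) :
    (envelopeAction d T).actDIV n e = e := by
  change actDIVEquiv d T n e = e
  refine Multiplicative.toAdd.injective (funext fun x => ?_)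
  rw [toAdd_actDIVEquiv]
  rcases x with c | j
  · simp only [permIdx, Equiv.sumCongr_symm, Equiv.sumCongr_apply, Sum.map_inl, MulAction.toPerm_symm_apply]
    rw [smul_fib_eq_of_mem_NΘ d T ((NΘ d T).inv_mem hn)]
  · simp only [permIdx, Equiv.sumCongr_symm, Equiv.sumCongr_apply, Sum.map_inr, MulAction.toPerm_symm_apply]
    rw [smul_fib_eq_of_mem_NΘ d T ((NΘ d T).inv_mem hn)]

end ArithThetaTower

end Literature.AnabelianGeometry.EtaleTheta

end
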